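import Summits.Ventures.HSemireg.UntwistCocycleTwist
import Literature.AlgebraicGeometry.Modules.LineBundleOfCocycleClass
import HarnessLib

/-!
# Venture HSemireg — which twist: `𝒪_X⟨c⟩` IS the line bundle of the cocycle `c` (th-4 file #15; anchor for files #11–#14)

HONEST FRAMING. A bookkeeping identification on the real carriers of `UntwistCocycleTwist.lean` and
`Modules/LineBundleOfCocycle.lean`. Nothing is asserted about any variety; no gerbe; nothing here says HC, HC_CM or HC_AV is
proved.

Files #11–#14 model «`F ⊗ M`» for the line bundle `M` of a Čech unit cocycle `c = (U_x, g_{xy})` as the cocycle twist `F⟨c⟩`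
(sections `(s_x ∈ Γ(F, V ∩ U_x))_x` with `s_x = g_{xy} · s_y`) and claim in their docstrings that «for `F = 𝒪_X` the relation is
literally that of `lineBundle c`». This file makes that claim a kernel statement — NUMBERS, NOT ADJECTIVES, «which twist»:
**`twistUnitIso c : twist c 𝒪_X ≅ lineBundle c`** (identity on glue families: a section of `𝒪_X⟨c⟩` and a section of the tree's
`lineBundle c` over `V` are the same family `(s_x ∈ Γ(X, V ∩ U_x))_x` with the same relation), hence `𝒪_X⟨c⟩` is finite locally
free OF RANK ONE with determinant (Picard) class `[c] ∈ Ȟ¹(X, 𝒪_X^×)` (`Modules/LineBundleOfCocycleClass.hasRank_lineBundle`,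
`detClass_lineBundle`). So the autoequivalence `twistEquivalence X c` of file #12 is `- ⊗ M` for THE line bundle `M` of class
`[c]` — at the `g = 4` anchor `M = M_B`, `c₁(M_B) = B = c₁(P)/2` made integral (t-12: `m` even).

## Contents (everything proved; 0 named facts; 0 sorry)

* `twistUnitToLineBundle c : twist c (unitModule X) ⟶ lineBundle c` and `lineBundleToTwistUnit c` (identity on families),
  `comp_twistUnitToLineBundle_app`, `comp_lineBundleToTwistUnit_app`;
* **`twistUnitIso c : twist c (unitModule X) ≅ lineBundle c`**.

## References

* R. Hartshorne, *Algebraic Geometry*, GTM 52 (1977), III Ex. 4.5 (`Pic X ≅ Ȟ¹(X, 𝒪_X^×)`), II Ex. 1.22. [Hartshorne1977]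
-/

noncomputable section

open CategoryTheory AlgebraicGeometry TopologicalSpace Opposite

namespace Summit.Ventures.HSemireg

open Literature.AlgebraicGeometry.Modules Literature.AlgebraicGeometry.Motives

universe u

variable {X : Scheme.{u}} (c : UnitCocycle X)

namespace CocycleTwist

/-- **`𝒪_X⟨c⟩ ⟶ lineBundle c`**: a section `(s_x)_x` of the twist of the structure sheaf IS a glue family of the line
bundle of `c` (same data, same relation `s_x = g_{xy} s_y`). [cite: Hartshorne1977, III Ex. 4.5] -/
def twistUnitToLineBundle : twist c (unitModule X) ⟶ lineBundle c where
  val := PresheafOfModules.homMk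
    { app := fun V => AddCommGrpCat.ofHom
        { toFun := fun s => c.mkSection V.unop (fun x => (comp c (unitModule X) (V := V.unop) s x : Γ(X, V.unop ⊓ c.U x)))
            fun x y V' hV hx hy => comp_rel c (unitModule X) (V := V.unop) s x y hV hx hy
          map_zero' := UnitCocycle.section_ext c fun _ => rfl
          map_add' := fun _ _ => UnitCocycle.section_ext c fun _ => rfl }
      naturality := fun {V W} i => by
        ext s
        exact UnitCocycle.section_ext c fun _ => rfl }
    (fun _ _ _ => UnitCocycle.section_ext c fun _ => rfl)

/-- Components are preserved by `twistUnitToLineBundle`. [folklore] -/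
@[simp]
theorem comp_twistUnitToLineBundle_app (V : X.Opens) (s : Γ(twist c (unitModule X), V)) (x : X) :
    c.comp ((twistUnitToLineBundle c).app V s) x = (comp c (unitModule X) s x : Γ(X, V ⊓ c.U x)) := rfl

/-- **`lineBundle c ⟶ 𝒪_X⟨c⟩`**: the inverse identification. [cite: Hartshorne1977, III Ex. 4.5] -/
def lineBundleToTwistUnit : lineBundle c ⟶ twist c (unitModule X) :=
  homMkTwist c (unitModule X)
    (fun V =>
      { toFun := fun s => mkFamily c (unitModule X) (fun x => (c.comp s x : Γ(unitModule X, V ⊓ c.U x)))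
          fun x y V' hV hx hy => c.comp_rel s x y V' hV hx hy
        map_zero' := twist_ext c (unitModule X) fun _ => rfl
        map_add' := fun _ _ => twist_ext c (unitModule X) fun _ => rfl })
    (fun _ _ _ _ _ => rfl) (fun _ _ _ _ => rfl)

/-- Components are preserved by `lineBundleToTwistUnit`. [folklore] -/
@[simp]
theorem comp_lineBundleToTwistUnit_app (V : X.Opens) (s : Γ(lineBundle c, V)) (x : X) :
    comp c (unitModule X) ((lineBundleToTwistUnit c).app V s) x = (c.comp s x : Γ(unitModule X, V ⊓ c.U x)) := rfl

/-- **Which twist: `𝒪_X⟨c⟩ ≅ lineBundle c`** — the cocycle twist of the structure sheaf is the tree's line bundle glued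
from `c` (so `- ⊗ M` of files #11–#14 is the twist by THE line bundle of Picard class `[c]`, by `hasRank_lineBundle` and
`detClass_lineBundle`). [cite: Hartshorne1977, III Ex. 4.5] -/
def twistUnitIso : twist c (unitModule X) ≅ lineBundle c where
  hom := twistUnitToLineBundle c
  inv := lineBundleToTwistUnit c
  hom_inv_id := by
    ext V s x
    rfl
  inv_hom_id := by
    ext V s x
    rfl

end CocycleTwist

end Summit.Ventures.HSemireg

end
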